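import Mathlib
import Summits.Ventures.PercRepro2.Defs
import Summits.Ventures.PercRepro2.Independence
import Summits.Ventures.PercRepro2.Harris

/-!
# Conditioning on a cylinder is the product law with modified weights (blind cell PercRepro2,
p1 g13; lead g24 INBOX 00:15Z «the only new objects: the exploration record T … and the
disintegration P¹(·) = Σ_T P(T) · P_{p_T}(·)»)

For a cylinder `cylinder F σ = {ω ∣ ω = σ on F}` put **`condWeights p F σ := p[e ↦ 1 if σ e, 0 if ¬σ e, on F]`**
(the edges of `F` forced into the states of `σ`; `isProbVec_condWeights`). Then, pointwise in the
configuration (**`weight_condWeights`**),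
`1_{cyl}(ω) · weight p ω = P(cyl) · weight (condWeights p F σ) ω` (and the right weight vanishes off
the cylinder), hence for every event `A` and every observable `f`:

* **`prob_inter_cylinder_eq`**: `P_p(A ∩ cyl) = P_p(cyl) · P_{condWeights}(A)`,
* **`expect_mul_cylinder_eq`**: `E_p[f · 1_{cyl}] = P_p(cyl) · E_{condWeights}[f]`

— conditioning on a cylinder IS the product law with the modified weights. This is the
disintegration step of PATHMIX / (PATH): over a family of cylinders `cyl T` that partition an event
(a stopping set, e.g. the exploration records of a canonical exploration — typer-1's object),
`P_p(A) = Σ_T P_p(cyl T) · P_{condWeights T}(A)` by summing (**`prob_eq_sum_cylinders`** for a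
finite family of pairwise disjoint cylinders covering `A`), and the within-record BHK parts are
`PathMixBHK.givenT_same_cluster` / `givenT_cross_cluster` at the modified weights (`condWeights p F σ`
is `PathMix.modWeights p (F.filter σ) (F.filter (¬ σ ·))`). Identities only. -/

namespace Summit.Ventures.PercRepro2

namespace CylinderCond

section Weights
variable {E : Type*} [Fintype E] [DecidableEq E] {R : Type*} [CommRing R]

/-- **The weights conditioned on a cylinder**: the edges of `F` forced into the states of `σ`. -/
def condWeights (p : E → R) (F : Finset E) (σ : Config E) : E → R :=
  fun e => if e ∈ F then (if σ e then 1 else 0) else p e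

omit [Fintype E] in
/-- Off `F` the conditioned weight is `p`. -/
lemma condWeights_of_notMem (p : E → R) (F : Finset E) (σ : Config E) {e : E} (h : e ∉ F) :
    condWeights p F σ e = p e := by
  simp [condWeights, h]

omit [Fintype E] in
/-- On `F` the edge factor of the conditioned weight is `1` in the prescribed state and `0` in the
other state. -/
lemma edgeFactor_condWeights (p : E → R) (F : Finset E) (σ : Config E) {e : E} (h : e ∈ F)
    (b : Bool) : edgeFactor (condWeights p F σ e) b = if b = σ e then 1 else 0 := by
  simp only [condWeights, h, if_true]
  cases hσ : σ e <;> cases b <;> simp [edgeFactor]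

/-- **Pointwise**: `1_{cyl}(ω) · weight p ω = P_p(cyl) · weight (condWeights p F σ) ω`. -/
theorem weight_condWeights (p : E → R) (F : Finset E) (σ : Config E) (ω : Config E) :
    (cylinder F σ).indicator (weight p) ω =
      prob p (cylinder F σ) * weight (condWeights p F σ) ω := by
  rw [prob_cylinder]
  by_cases hω : ω ∈ cylinder F σ
  · rw [Set.indicator_of_mem hω]
    unfold weight
    rw [← Finset.prod_mul_prod_compl F (fun e => edgeFactor (p e) (ω e)),
      ← Finset.prod_mul_prod_compl F (fun e => edgeFactor (condWeights p F σ e) (ω e))]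
    have h1 : ∏ e ∈ F, edgeFactor (p e) (ω e) = ∏ e ∈ F, edgeFactor (p e) (σ e) :=
      Finset.prod_congr rfl fun e he => by rw [hω e he]
    have h2 : ∏ e ∈ F, edgeFactor (condWeights p F σ e) (ω e) = 1 := by
      refine Finset.prod_eq_one fun e he => ?_
      rw [edgeFactor_condWeights p F σ he, hω e he, if_pos rfl]
    have h3 : ∏ e ∈ Fᶜ, edgeFactor (condWeights p F σ e) (ω e) =
        ∏ e ∈ Fᶜ, edgeFactor (p e) (ω e) :=
      Finset.prod_congr rfl fun e he => by
        rw [condWeights_of_notMem p F σ (Finset.mem_compl.1 he)]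
    rw [h1, h2, h3]
    ring
  · rw [Set.indicator_of_notMem hω]
    unfold weight
    have : ∃ e ∈ F, ω e ≠ σ e := by
      simp only [mem_cylinder, not_forall, exists_prop] at hω
      exact hω
    obtain ⟨e, he, hne⟩ := this
    have hz : edgeFactor (condWeights p F σ e) (ω e) = 0 := by
      rw [edgeFactor_condWeights p F σ he, if_neg hne]
    rw [Finset.prod_eq_zero (Finset.mem_univ e) hz, mul_zero]

/-- Off the cylinder the conditioned weight vanishes. -/
lemma weight_condWeights_of_notMem (p : E → R) (F : Finset E) (σ : Config E) {ω : Config E}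
    (hω : ω ∉ cylinder F σ) : weight (condWeights p F σ) ω = 0 := by
  have : ∃ e ∈ F, ω e ≠ σ e := by
    simp only [mem_cylinder, not_forall, exists_prop] at hω
    exact hω
  obtain ⟨e, he, hne⟩ := this
  unfold weight
  exact Finset.prod_eq_zero (Finset.mem_univ e) (by rw [edgeFactor_condWeights p F σ he, if_neg hne])

end Weights

section Laws
variable {E : Type*} [Fintype E] [DecidableEq E] {R : Type*} [CommRing R]

/-- **Conditioning on a cylinder is the modified product law (events)**:
`P_p(A ∩ cyl) = P_p(cyl) · P_{condWeights}(A)`. -/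
theorem prob_inter_cylinder_eq (p : E → R) (F : Finset E) (σ : Config E) (A : Set (Config E)) :
    prob p (A ∩ cylinder F σ) = prob p (cylinder F σ) * prob (condWeights p F σ) A := by
  set c := prob p (cylinder F σ) with hc
  have hpt : ∀ ω, (cylinder F σ).indicator (weight p) ω = c * weight (condWeights p F σ) ω :=
    fun ω => by rw [hc]; exact weight_condWeights p F σ ω
  unfold prob
  rw [Finset.mul_sum]
  refine Finset.sum_congr rfl fun ω _ => ?_
  by_cases hA : ω ∈ A
  · have e1 : (A ∩ cylinder F σ).indicator (weight p) ω = (cylinder F σ).indicator (weight p) ω := by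
      by_cases hcy : ω ∈ cylinder F σ
      · rw [Set.indicator_of_mem (show ω ∈ A ∩ cylinder F σ from ⟨hA, hcy⟩),
          Set.indicator_of_mem hcy]
      · rw [Set.indicator_of_notMem (fun h => hcy h.2), Set.indicator_of_notMem hcy]
    rw [e1, hpt, Set.indicator_of_mem hA]
  · rw [Set.indicator_of_notMem (fun h => hA h.1), Set.indicator_of_notMem hA, mul_zero]

/-- **Conditioning on a cylinder is the modified product law (observables)**:
`E_p[f · 1_{cyl}] = P_p(cyl) · E_{condWeights}[f]`. -/
theorem expect_mul_cylinder_eq (p : E → R) (F : Finset E) (σ : Config E) (f : Config E → R) :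
    expect p (fun ω => f ω * (cylinder F σ).indicator 1 ω) =
      prob p (cylinder F σ) * expect (condWeights p F σ) f := by
  set c := prob p (cylinder F σ) with hc
  have hpt : ∀ ω, (cylinder F σ).indicator (weight p) ω = c * weight (condWeights p F σ) ω :=
    fun ω => by rw [hc]; exact weight_condWeights p F σ ω
  unfold expect
  rw [Finset.mul_sum]
  refine Finset.sum_congr rfl fun ω _ => ?_
  have h := hpt ω
  by_cases hcy : ω ∈ cylinder F σ
  · rw [Set.indicator_of_mem hcy] at h
    show weight p ω * (f ω * (cylinder F σ).indicator 1 ω) = c * (weight (condWeights p F σ) ω * f ω)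
    rw [Set.indicator_of_mem hcy, h]
    simp only [Pi.one_apply]
    ring
  · show weight p ω * (f ω * (cylinder F σ).indicator 1 ω) = c * (weight (condWeights p F σ) ω * f ω)
    rw [Set.indicator_of_notMem hcy, weight_condWeights_of_notMem p F σ hcy]
    simp

/-- **Disintegration over a finite family of pairwise disjoint cylinders covering an event**:
`P_p(A) = Σ_T P_p(cyl T) · P_{condWeights T}(A)`. -/
theorem prob_eq_sum_cylinders (p : E → R) {ι : Type*} (s : Finset ι) (F : ι → Finset E)
    (σ : ι → Config E) (A : Set (Config E))
    (hcov : ∀ ω ∈ A, ∃ T ∈ s, ω ∈ cylinder (F T) (σ T))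
    (hdisj : ∀ T ∈ s, ∀ T' ∈ s, T ≠ T' → Disjoint (cylinder (F T) (σ T)) (cylinder (F T') (σ T'))) :
    prob p A = ∑ T ∈ s, prob p (cylinder (F T) (σ T)) * prob (condWeights p (F T) (σ T)) A := by
  classical
  simp_rw [← prob_inter_cylinder_eq]
  unfold prob
  rw [Finset.sum_comm]
  refine Finset.sum_congr rfl fun ω _ => ?_
  by_cases hA : ω ∈ A
  · obtain ⟨T₀, hT₀, hωT₀⟩ := hcov ω hA
    rw [Set.indicator_of_mem hA, Finset.sum_eq_single T₀]
    · rw [Set.indicator_of_mem (show ω ∈ A ∩ cylinder (F T₀) (σ T₀) from ⟨hA, hωT₀⟩)]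
    · intro T hT hne
      rw [Set.indicator_of_notMem]
      rintro ⟨_, hωT⟩
      exact Set.disjoint_left.1 (hdisj T hT T₀ hT₀ hne) hωT hωT₀
    · intro h; exact absurd hT₀ h
  · rw [Set.indicator_of_notMem hA]
    symm
    exact Finset.sum_eq_zero fun T _ => Set.indicator_of_notMem (fun h => hA h.1) _

end Laws

section ProbVec
variable {E : Type*} [Fintype E] [DecidableEq E] {R : Type*} [CommRing R] [LinearOrder R]
  [IsStrictOrderedRing R]

omit [Fintype E] in
/-- The conditioned weights form a probability vector. -/
theorem isProbVec_condWeights {p : E → R} (hp : IsProbVec p) (F : Finset E) (σ : Config E) :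
    IsProbVec (condWeights p F σ) := by
  refine ⟨fun e => ?_, fun e => ?_⟩
  · unfold condWeights
    split_ifs
    · exact zero_le_one
    · exact le_rfl
    · exact hp.nonneg e
  · unfold condWeights
    split_ifs
    · exact le_rfl
    · exact zero_le_one
    · exact hp.le_one e

end ProbVec

end CylinderCond

end Summit.Ventures.PercRepro2
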